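import Summits.NavierStokesRegularity.FluidComputer.PeriodicProfileClockRigidity
import Mathlib.Algebra.Order.ToIntervalMod
import HarnessLib

/-!
# Clock rigidity of a discretely self-similar profile — LOCAL form (momentum equation on a
# parabolic neighbourhood of the singular point only)

Summit `NavierStokesRegularity`, cell topic directory `FluidComputer`, namespace
`…FluidComputer.SelfSimilarCensus`; zone Z7 of the D-0081 profile search. Sequel of
`PeriodicProfileClockRigidity.lean`, which asks the momentum equation of the modulated ansatz
`u(θ(σ), x) = ℓ(σ) • W(σ, ℓ(σ) • x)` (profile `W` jointly `C¹` and `P`-PERIODIC in the similarity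
time `σ`, ARBITRARY clock `θ′ = ℓ⁻²`) on whole slices `x ∈ E`. A blow-up profile is a LOCAL object:
here the equation is only assumed on the parabolic neighbourhood `{θ(σ) : σ > σ₀} × B(0, r)` of the
singular point, together with the COLLAPSE of the length scale, `ℓ(σ) → +∞` (so that `y = ℓ(σ) x`
sweeps every point of `E`). This is the `σ`-periodic twin of `ModulatedCollapseGaugeRigidityLocal.lean`
(eng-11 lineage; steady profile). PROVED theorems only; no definitions, no named facts.

## Content

* §1 READOUT ⇒ RIGIDITY, equation-free: `scaleFactor_of_readoutPeriodic`,
  `blowupRigidity_of_readoutPeriodic` — the conclusions of `periodicProfile_scaleFactor` /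
  `periodicProfile_blowup_rigidity` (one scale factor `c`, covariance
  `u(θ(σ + P), x) = c • u(θ(σ), c • x)`; on the blow-up branch `c > 1`,
  `T − θ(σ + P) = (T − θ(σ))/c²`, `u(T − (T − θ(σ))/c², x) = c • u(θ(σ), c • x)`,
  `0 < m ≤ (T − θ)ℓ² ≤ M`) from the PERIODIC READOUT `ℓ′(σ + P)/ℓ(σ + P) = ℓ′(σ)/ℓ(σ)` alone — the
  only place the momentum equation enters the global file. (Same proofs; recorded so that any source
  of readout periodicity, in particular the local one below, feeds the rigidity.)
* §2 `exists_radius_scalingGenerator_ne` — COMPACTNESS OVER ONE PERIOD: for a jointly `C¹`,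
  `P`-periodic profile with no vanishing slice there is ONE radius `R` such that every slice has a
  point `‖y‖ < R` where the scaling generator `W(σ, y) + D_yW(σ, y) y` is non-zero (finite subcover
  of `[0, P]` by the open sets `{σ : W(σ, y) + D_yW(σ, y) y ≠ 0}`, `y ∈ E`, then periodicity via
  `toIcoMod`).
* §3 LOCAL READOUT PERIODICITY: `twoTerm_of_momentum_profile_ball` (the two-term identity at
  `(σ, y)` whenever `ℓ(σ)⁻¹ y ∈ B(0, r)`), `readout_add_period_eq_of_ball` (one non-degenerate point
  inside both balls suffices), `eventually_readout_add_period_eq` (with `ℓ → +∞`: the readout is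
  periodic for every `σ` beyond some `σ₂ ≥ σ₀`).
* §4 HEADLINE `periodicProfile_blowup_rigidity_local`: under the local hypotheses and on the blow-up
  branch `θ → T`, beyond some similarity time `σ₂` all conclusions of
  `periodicProfile_blowup_rigidity` hold — near the singular point an exact DSS object in ANY clock is
  DSS in Leray's gauge up to a bounded periodic factor; no logarithmic (or any secular) correction.
  The physical-time consequences (`PeriodicProfileSingularPoint`, `PeriodicProfileTypeIRate`) follow
  from these conclusions verbatim with `σ₀` replaced by `σ₂`.

WHAT THIS IS NOT: not an existence or non-existence claim for DSS profiles, not a regularity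
theorem, not Navier–Stokes evidence; the ansatz (a re-parametrisation of `u` at the clock times) and
the pressure ansatz are kept on whole slices — only the EQUATION is localised; «violates: none — no
object».

References: J. Leray, Acta Math. 63 (1934), §20 [Leray1934]; D. Chae, J. Wolf, Arch. Rational Mech.
Anal. 225 (2017), Def. 1.1 [ChaeWolf2017RemovingDSS].
-/

noncomputable section

open Set Filter Topology InnerProductSpace Function Metric
open scoped Laplacian RealInnerProductSpace

namespace Summit.NavierStokesRegularity.FluidComputer.SelfSimilarCensus

open Literature.Analysis.FluidPDE

/-! ### §1 From a periodic readout to the rigidity (no equation) -/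

section OfReadout

variable {E : Type*} [NormedAddCommGroup E] [NormedSpace ℝ E]
variable {W : ℝ → E → E} {u : ℝ → E → E} {ℓ ℓ' θ : ℝ → ℝ} {P σ₀ T : ℝ}

/-! Standing hypotheses of §1: `P > 0`; on `σ > σ₀`, `ℓ > 0` with derivative `ℓ′` and a
`P`-periodic profile in the ansatz at the clock times; each theorem takes the `P`-PERIODIC READOUT
`hb : ℓ′(σ + P)/ℓ(σ + P) = ℓ′(σ)/ℓ(σ)` (`σ > σ₀`) as its explicit hypothesis. -/
variable (hP : 0 < P) (hℓ : ∀ σ, σ₀ < σ → HasDerivAt ℓ (ℓ' σ) σ) (hpos : ∀ σ, σ₀ < σ → 0 < ℓ σ)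
  (hper : ∀ s, W (s + P) = W s)
  (hans : ∀ σ, σ₀ < σ → ∀ x, u (θ σ) x = ℓ σ • W σ (ℓ σ • x))
include hP hℓ hpos hper hans

/-- **One scale factor and the covariance, from the periodic readout.** There is `c > 0` with
`ℓ(σ + P) = c ℓ(σ)` and `u(θ(σ + P), x) = c • u(θ(σ), c • x)` for all `σ > σ₀`, `x` (the proof of
`periodicProfile_scaleFactor`, with the readout periodicity as the hypothesis). [folklore] -/
theorem scaleFactor_of_readoutPeriodic (hb : ∀ σ, σ₀ < σ → ℓ' (σ + P) / ℓ (σ + P) = ℓ' σ / ℓ σ) :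
    ∃ c : ℝ, 0 < c ∧ (∀ σ, σ₀ < σ → ℓ (σ + P) = c * ℓ σ) ∧
      ∀ σ, σ₀ < σ → ∀ x : E, u (θ (σ + P)) x = c • u (θ σ) (c • x) := by
  -- the period ratio is the same at every `σ > σ₀`: compare both with the base point `min σ (σ₀ + 1)`
  have hratio : ∀ σ, σ₀ < σ → ℓ (σ + P) / ℓ σ = ℓ (σ₀ + 1 + P) / ℓ (σ₀ + 1) := by
    intro σ hσ
    have hb0 : σ₀ < min σ (σ₀ + 1) := lt_min hσ (by linarith)
    have e := fun s (hs : min σ (σ₀ + 1) ≤ s) =>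
      periodRatio_eq (σ₀ := min σ (σ₀ + 1)) hP.le (fun s hs => hℓ s (lt_of_lt_of_le hb0 hs))
        (fun s hs => (hpos s (lt_of_lt_of_le hb0 hs)).ne') (fun s hs => hb s (lt_of_lt_of_le hb0 hs)) hs
    rw [e σ (min_le_left _ _), e (σ₀ + 1) (min_le_right _ _)]
  refine ⟨ℓ (σ₀ + 1 + P) / ℓ (σ₀ + 1), div_pos (hpos _ (by linarith)) (hpos _ (by linarith)),
    fun σ hσ => ?_, fun σ hσ x => ?_⟩
  · rw [← hratio σ hσ, div_mul_cancel₀ _ (hpos σ hσ).ne']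
  · have hcσ : ℓ (σ + P) = ℓ (σ₀ + 1 + P) / ℓ (σ₀ + 1) * ℓ σ := by
      rw [← hratio σ hσ, div_mul_cancel₀ _ (hpos σ hσ).ne']
    rw [hans (σ + P) (by linarith), hans σ hσ, hper, hcσ]
    simp only [smul_smul]
    rw [mul_comm (ℓ σ) (ℓ (σ₀ + 1 + P) / ℓ (σ₀ + 1))]

/-- **Blow-up rigidity from the periodic readout.** With `θ′ = ℓ⁻²` on `σ > σ₀` and bounded
physical time `θ(σ) → T`: there is `c > 1` with `ℓ(σ + P) = c ℓ(σ)`,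
`T − θ(σ + P) = (T − θ(σ))/c²`, `θ(σ) < T`, `u(T − (T − θ(σ))/c², x) = c • u(θ(σ), c • x)`, and
`0 < m ≤ (T − θ(σ)) ℓ(σ)² ≤ M`, all for `σ > σ₀` (the proof of `periodicProfile_blowup_rigidity`,
with the readout periodicity as the hypothesis). [folklore] -/
theorem blowupRigidity_of_readoutPeriodic (hb : ∀ σ, σ₀ < σ → ℓ' (σ + P) / ℓ (σ + P) = ℓ' σ / ℓ σ)
    (hθ : ∀ σ, σ₀ < σ → HasDerivAt θ ((ℓ σ ^ 2)⁻¹) σ) (hT : Tendsto θ atTop (𝓝 T)) :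
    ∃ c : ℝ, 1 < c ∧ (∀ σ, σ₀ < σ → ℓ (σ + P) = c * ℓ σ) ∧
      (∀ σ, σ₀ < σ → T - θ (σ + P) = (T - θ σ) / c ^ 2) ∧ (∀ σ, σ₀ < σ → θ σ < T) ∧
      (∀ σ, σ₀ < σ → ∀ x : E, u (T - (T - θ σ) / c ^ 2) x = c • u (θ σ) (c • x)) ∧
      ∃ m M : ℝ, 0 < m ∧ m ≤ M ∧
        ∀ σ, σ₀ < σ → m ≤ (T - θ σ) * ℓ σ ^ 2 ∧ (T - θ σ) * ℓ σ ^ 2 ≤ M := by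
  obtain ⟨c, hc, hcl, hcov⟩ := scaleFactor_of_readoutPeriodic hP hℓ hpos hper hans hb
  have hθr : ∀ σ, σ₀ < σ → ∀ s, σ ≤ s → HasDerivAt θ ((ℓ s ^ 2)⁻¹) s :=
    fun σ hσ s hs => hθ s (lt_of_lt_of_le hσ hs)
  have hner : ∀ σ, σ₀ < σ → ∀ s, σ ≤ s → ℓ s ≠ 0 :=
    fun σ hσ s hs => (hpos s (lt_of_lt_of_le hσ hs)).ne'
  have hclr : ∀ σ, σ₀ < σ → ∀ s, σ ≤ s → ℓ (s + P) = c * ℓ s :=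
    fun σ hσ s hs => hcl s (lt_of_lt_of_le hσ hs)
  have hfix : ∀ σ, σ₀ < σ → T - θ (σ + P) = (T - θ σ) / c ^ 2 := by
    intro σ hσ
    obtain ⟨d, hd⟩ := exists_periodShift hP.le (hθr σ hσ) (hner σ hσ) hc.ne' (hclr σ hσ)
    exact periodShift_eq_of_tendsto hd hT le_rfl
  have hmono : ∀ σ, σ₀ < σ → StrictMonoOn θ (Ici σ) :=
    fun σ hσ => strictMonoOn_time (hθr σ hσ) (hner σ hσ)
  have hlt : ∀ σ, σ₀ < σ → θ σ < T := fun σ hσ => time_lt_blowupTime hP (hmono σ hσ) hT le_rfl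
  have hc1 : 1 < c := by
    have h1 : σ₀ < σ₀ + 1 := lt_add_one σ₀
    obtain ⟨d, hd⟩ := exists_periodShift hP.le (hθr _ h1) (hner _ h1) hc.ne' (hclr _ h1)
    exact one_lt_scaleFactor hP (hmono _ h1) hc hd hT
  have hP1 : σ₀ < σ₀ + P := by linarith
  obtain ⟨m, M, hm, hmM, hbd⟩ := exists_bounds_sub_time_mul_sq (σ₀ := σ₀ + P) hP hc
    (fun s hs => (hℓ s (lt_of_lt_of_le hP1 hs)).differentiableAt)
    (fun s hs => hpos s (lt_of_lt_of_le hP1 hs)) (hθr _ hP1) (hclr _ hP1)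
    (fun s hs => hfix s (lt_of_lt_of_le hP1 hs)) (fun s hs => hlt s (lt_of_lt_of_le hP1 hs))
  refine ⟨c, hc1, hcl, hfix, hlt, fun σ hσ x => ?_, m, M, hm, hmM, fun σ hσ => ?_⟩
  · have ht : T - (T - θ σ) / c ^ 2 = θ (σ + P) := by linarith [hfix σ hσ]
    rw [ht, hcov σ hσ x]
  · by_cases h : σ₀ + P ≤ σ
    · exact hbd σ h
    · have h2 := hbd (σ + P) (by linarith)
      rwa [sub_time_mul_sq_add_period hc.ne' (hcl σ hσ) (hfix σ hσ)] at h2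

end OfReadout

/-! ### §2 Compactness over one period: a uniform radius of non-degenerate points -/

section Radius

variable {E : Type*} [NormedAddCommGroup E] [NormedSpace ℝ E]
variable {F : Type*} [NormedAddCommGroup F] [NormedSpace ℝ F]
variable {W : ℝ → E → F} {P : ℝ}

/-- For a jointly `C¹` profile, the scaling generator `σ ↦ W(σ, y) + D_yW(σ, y) y` at a fixed
point `y` is continuous in the similarity time. [folklore] -/
theorem continuous_scalingGenerator_slice (hW : ContDiff ℝ 1 (uncurry W)) (y : E) :
    Continuous fun σ => W σ y + fderiv ℝ (W σ) y y := by
  have hpair : Continuous fun σ : ℝ => (σ, y) := continuous_id.prodMk continuous_const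
  have h1 : Continuous fun σ => W σ y := hW.continuous.comp hpair
  have hD : Continuous fun σ => fderiv ℝ (uncurry W) (σ, y) := (hW.continuous_fderiv one_ne_zero).comp hpair
  have h2 : Continuous fun σ => fderiv ℝ (uncurry W) (σ, y) ((0 : ℝ), y) := hD.clm_apply continuous_const
  refine (h1.add h2).congr fun σ => ?_
  rw [Pi.add_apply, fderiv_slice_space_apply (hW.differentiable one_ne_zero _).hasFDerivAt]

/-- **ONE RADIUS FOR ALL SLICES.** If `W` is jointly `C¹`, `P`-periodic in `σ` (`P > 0`) and no
slice vanishes identically, there is `R` such that EVERY slice has a point `‖y‖ < R` with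
`W(σ, y) + D_yW(σ, y) y ≠ 0`. (Each slice has such a point by Euler's homogeneity lemma
`eq_zero_of_scalingGenerator_eq_zero`; the open sets `{σ : W(σ, y) + D_yW(σ, y) y ≠ 0}`, `y ∈ E`,
cover the compact period `[0, P]`, finitely many suffice, and periodicity (`toIcoMod`) transports the
bound to every `σ`.) [folklore] -/
theorem exists_radius_scalingGenerator_ne (hW : ContDiff ℝ 1 (uncurry W)) (hP : 0 < P)
    (hper : ∀ s, W (s + P) = W s) (hW0 : ∀ σ, W σ ≠ 0) :
    ∃ R : ℝ, ∀ σ, ∃ y : E, ‖y‖ < R ∧ W σ y + fderiv ℝ (W σ) y y ≠ 0 := by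
  set G : ℝ → E → F := fun σ y => W σ y + fderiv ℝ (W σ) y y with hG
  -- every slice has a non-degenerate point
  have hex : ∀ σ, ∃ y, G σ y ≠ 0 := by
    intro σ
    by_contra h
    push Not at h
    exact hW0 σ (eq_zero_of_scalingGenerator_eq_zero (hW.comp (contDiff_prodMk_right σ)) h)
  -- finite subcover of the period `[0, P]`
  set O : E → Set ℝ := fun y => {σ | G σ y ≠ 0} with hO
  have hOopen : ∀ y, IsOpen (O y) := fun y =>
    isOpen_ne_fun (continuous_scalingGenerator_slice hW y) continuous_const
  have hcover : Icc 0 P ⊆ ⋃ y, O y := fun σ _ => by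
    obtain ⟨y, hy⟩ := hex σ
    exact mem_iUnion.2 ⟨y, hy⟩
  obtain ⟨t, ht⟩ := isCompact_Icc.elim_finite_subcover O hOopen hcover
  refine ⟨1 + ∑ y ∈ t, ‖y‖, fun σ => ?_⟩
  -- reduce `σ` to the period by periodicity
  have hperiodic : Function.Periodic W P := hper
  set σ' := toIcoMod hP 0 σ with hσ'
  have hmem : σ' ∈ Icc 0 P := by
    have h := toIcoMod_mem_Ico hP 0 σ
    rw [zero_add] at h
    exact Ico_subset_Icc_self h
  have hWσ : W σ = W σ' := by
    have h1 : σ' + toIcoDiv hP 0 σ • P = σ := toIcoMod_add_toIcoDiv_zsmul hP 0 σ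
    rw [← h1]
    exact (hperiodic.zsmul (toIcoDiv hP 0 σ)) σ'
  obtain ⟨y, hyt, hy⟩ := mem_iUnion₂.1 (ht hmem)
  refine ⟨y, ?_, ?_⟩
  · have : ‖y‖ ≤ ∑ z ∈ t, ‖z‖ := Finset.single_le_sum (fun z _ => norm_nonneg z) hyt
    linarith
  · have hy' : G σ' y ≠ 0 := hy
    simp only [hG] at hy' ⊢
    rwa [hWσ]

end Radius

/-! ### §3 The momentum equation on a parabolic neighbourhood makes the readout eventually periodic -/

section LocalReadout

variable {E : Type*} [NormedAddCommGroup E] [InnerProductSpace ℝ E] [FiniteDimensional ℝ E]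
variable {W : ℝ → E → E} {Q : ℝ → E → ℝ} {u : ℝ → E → E} {p : ℝ → E → ℝ}
  {ℓ ℓ' θ : ℝ → ℝ} {ν P σ₀ r T : ℝ}

/-! Standing hypotheses of §3–§4: those of `PeriodicProfileClockRigidity` §4 on the open half-line
`σ > σ₀` (`ℓ > 0` with derivative `ℓ′`, `θ′ = ℓ⁻²`, `P > 0`, `W` jointly `C¹` and `P`-periodic
with every slice `W(σ, ·) ≢ 0`, `Q` `P`-periodic, the ansatz and the pressure ansatz at the clock
times, `t ↦ u(t, x)` differentiable at the clock times) EXCEPT that the momentum equation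
`∂ₜu + (u·∇)u + ∇p − νΔu = 0` is asked only for `x ∈ B(0, r)`, `r > 0`; plus the collapse of the
length scale `ℓ(σ) → +∞`. -/
variable (hP : 0 < P) (hr : 0 < r) (hℓ : ∀ σ, σ₀ < σ → HasDerivAt ℓ (ℓ' σ) σ)
  (hpos : ∀ σ, σ₀ < σ → 0 < ℓ σ) (hgrow : Tendsto ℓ atTop atTop)
  (hθ : ∀ σ, σ₀ < σ → HasDerivAt θ ((ℓ σ ^ 2)⁻¹) σ) (hW : ContDiff ℝ 1 (uncurry W))
  (hper : ∀ s, W (s + P) = W s) (hperQ : ∀ s, Q (s + P) = Q s)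
  (hW0 : ∀ σ, σ₀ < σ → W σ ≠ 0)
  (hans : ∀ σ, σ₀ < σ → ∀ x, u (θ σ) x = ℓ σ • W σ (ℓ σ • x))
  (hp : ∀ σ, σ₀ < σ → p (θ σ) = fun x => ℓ σ ^ 2 * Q σ (ℓ σ • x))
  (hu : ∀ σ, σ₀ < σ → ∀ x, DifferentiableAt ℝ (fun t => u t x) (θ σ))
  (heq : ∀ σ, σ₀ < σ → ∀ x ∈ ball (0 : E) r,
    timeDeriv u (θ σ) x + convect (u (θ σ)) (u (θ σ)) x + gradient (p (θ σ)) x -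
      ν • (Δ (u (θ σ))) x = 0)

include hθ hℓ hpos hW hans hp hu heq in
/-- **The two-term identity at `(σ, y)` whenever `ℓ(σ)⁻¹ y ∈ B(0, r)`**:
`(ℓ²ℓ′)(σ) • (W + D_yW y)(σ, y) + ℓ(σ)³ • (∂_σW + (W·∇)W + ∇Q − νΔW)(σ, y) = 0`
(`momentum_modulatedProfile` at `x = ℓ(σ)⁻¹ y`). [folklore] -/
theorem twoTerm_of_momentum_profile_ball {σ : ℝ} (hσ : σ₀ < σ) {y : E}
    (hy : (ℓ σ)⁻¹ • y ∈ ball (0 : E) r) :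
    (ℓ σ ^ 2 * ℓ' σ) • (W σ y + fderiv ℝ (W σ) y y) +
      ℓ σ ^ 3 • (deriv (fun s => W s y) σ + convect (W σ) (W σ) y + gradient (Q σ) y -
        ν • (Δ (W σ)) y) = 0 := by
  have hev : ∀ᶠ s in 𝓝 σ, ∀ x, u (θ s) x = ℓ s • W s (ℓ s • x) :=
    Filter.eventually_of_mem (isOpen_Ioi.mem_nhds hσ) fun s hs => hans s hs
  have hx := heq σ hσ ((ℓ σ)⁻¹ • y) hy
  rw [momentum_modulatedProfile (hθ σ hσ) (hℓ σ hσ) (hpos σ hσ).ne'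
    (fun y => hW.differentiable one_ne_zero _) hev (hp σ hσ) (hu σ hσ) ν, smul_smul,
    mul_inv_cancel₀ (hpos σ hσ).ne', one_smul] at hx
  exact hx

include hP hθ hℓ hpos hW hper hperQ hans hp hu heq in
/-- **One non-degenerate point inside both balls makes the readout periodic.** If `σ, σ + P > σ₀`,
`W(σ, y₀) + D_yW(σ, y₀) y₀ ≠ 0`, and `y₀` lies in both rescaled balls, `‖y₀‖ < ℓ(σ) r` and
`‖y₀‖ < ℓ(σ + P) r`, then `ℓ′(σ + P)/ℓ(σ + P) = ℓ′(σ)/ℓ(σ)` (the proof of `readout_add_period_eq`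
run at the single point `y₀`). [folklore] -/
theorem readout_add_period_eq_of_ball {σ : ℝ} (hσ : σ₀ < σ) {y₀ : E}
    (hy₀ : W σ y₀ + fderiv ℝ (W σ) y₀ y₀ ≠ 0) (h1 : ‖y₀‖ < ℓ σ * r) (h2 : ‖y₀‖ < ℓ (σ + P) * r) :
    ℓ' (σ + P) / ℓ (σ + P) = ℓ' σ / ℓ σ := by
  have hσP : σ₀ < σ + P := by linarith
  have h0 := hpos σ hσ
  have hP0 := hpos (σ + P) hσP
  have hball : ∀ {s : ℝ}, 0 < ℓ s → ‖y₀‖ < ℓ s * r → (ℓ s)⁻¹ • y₀ ∈ ball (0 : E) r := by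
    intro s hs hlt
    rw [mem_ball_zero_iff, norm_smul, norm_inv, Real.norm_of_nonneg hs.le, inv_mul_lt_iff₀ hs]
    exact hlt
  -- the two-term identity on the pair `{σ, σ + P}` at the single point `y₀`, fields frozen at `σ`
  have hpair : ∀ s ∈ ({σ, σ + P} : Set ℝ), ∀ _ : Unit,
      (ℓ s ^ 2 * ℓ' s) • (W σ y₀ + fderiv ℝ (W σ) y₀ y₀) +
        ℓ s ^ 3 • (deriv (fun s => W s y₀) σ + convect (W σ) (W σ) y₀ + gradient (Q σ) y₀ -
          ν • (Δ (W σ)) y₀) = 0 := by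
    intro s hs _
    rcases hs with rfl | rfl
    · exact twoTerm_of_momentum_profile_ball hℓ hpos hθ hW hans hp hu heq hσ (hball h0 h1)
    · have h := twoTerm_of_momentum_profile_ball hℓ hpos hθ hW hans hp hu heq hσP (hball hP0 h2)
      rwa [deriv_slice_add_period hper, hper, hperQ] at h
  have key := mul_eq_mul_of_twoTerm (f := fun s => ℓ s ^ 2 * ℓ' s) (g := fun s => ℓ s ^ 3)
    (W := fun _ : Unit => W σ y₀ + fderiv ℝ (W σ) y₀ y₀) hpair (y₀ := ()) hy₀
    (show σ ∈ ({σ, σ + P} : Set ℝ) by simp) (show σ + P ∈ ({σ, σ + P} : Set ℝ) by simp)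
  rw [div_eq_div_iff hP0.ne' h0.ne']
  have hne : ℓ σ ^ 2 * ℓ (σ + P) ^ 2 ≠ 0 := by positivity
  refine mul_left_cancel₀ hne ?_
  linear_combination -key

include hP hr hℓ hpos hgrow hθ hW hper hperQ hW0 hans hp hu heq in
/-- **THE READOUT IS EVENTUALLY PERIODIC.** Under the local hypotheses there is `σ₂ ≥ σ₀` with
`ℓ′(σ + P)/ℓ(σ + P) = ℓ′(σ)/ℓ(σ)` for every `σ > σ₂`: take the uniform radius `R` of
`exists_radius_scalingGenerator_ne` and `σ₂` beyond which `ℓ > R/r`. [folklore] -/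
theorem eventually_readout_add_period_eq :
    ∃ σ₂ : ℝ, σ₀ ≤ σ₂ ∧ ∀ σ, σ₂ < σ → ℓ' (σ + P) / ℓ (σ + P) = ℓ' σ / ℓ σ := by
  -- no slice vanishes (periodicity carries `hW0` below `σ₀`)
  have hperiodic : Function.Periodic W P := hper
  have hW0' : ∀ σ, W σ ≠ 0 := by
    intro σ
    obtain ⟨n, hn⟩ := exists_nat_gt ((σ₀ - σ) / P)
    have hσn : σ₀ < σ + n * P := by
      rw [div_lt_iff₀ hP] at hn
      linarith
    rw [← (hperiodic.nat_mul n) σ]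
    exact hW0 _ hσn
  obtain ⟨R, hR⟩ := exists_radius_scalingGenerator_ne hW hP hper hW0'
  -- beyond `σ₂`, `ℓ r > R`
  obtain ⟨σ₁, hσ₁⟩ := (hgrow.eventually_gt_atTop (R / r)).exists_forall_of_atTop
  refine ⟨max σ₀ σ₁, le_max_left _ _, fun σ hσ => ?_⟩
  have hσ₀ : σ₀ < σ := lt_of_le_of_lt (le_max_left _ _) hσ
  have hσ1 : σ₁ ≤ σ := (le_max_right _ _).trans hσ.le
  obtain ⟨y₀, hy₀R, hy₀⟩ := hR σ
  have hlt : ∀ s, σ₁ ≤ s → ‖y₀‖ < ℓ s * r := fun s hs => by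
    have h := hσ₁ s hs
    rw [div_lt_iff₀ hr] at h
    exact hy₀R.trans h
  exact readout_add_period_eq_of_ball hP hℓ hpos hθ hW hper hperQ hans hp hu heq hσ₀ hy₀ (hlt σ hσ1)
    (hlt (σ + P) (by linarith))

/-! ### §4 Headline: local clock rigidity of an exactly discretely self-similar object -/

include hP hr hℓ hpos hgrow hθ hW hper hperQ hW0 hans hp hu heq in
/-- **LOCAL BLOW-UP RIGIDITY OF AN EXACT DSS OBJECT IN AN ARBITRARY CLOCK.** Under the local
hypotheses (momentum equation on the parabolic neighbourhood `{θ(σ)} × B(0, r)` only, `ℓ → +∞`)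
and on the blow-up branch `θ(σ) → T`, there are `σ₂ ≥ σ₀` and `c > 1` with, for every `σ > σ₂`:
`ℓ(σ + P) = c ℓ(σ)`; `T − θ(σ + P) = (T − θ(σ))/c²`; `θ(σ) < T`; the PARABOLIC discrete
self-similarity `u(T − (T − θ(σ))/c², x) = c • u(θ(σ), c • x)`; and `0 < m ≤ (T − θ(σ)) ℓ(σ)² ≤ M`.
Near the singular point the clock of an exact DSS object is Leray's up to a bounded periodic
factor — no logarithmic (or any secular) correction. [folklore] -/
theorem periodicProfile_blowup_rigidity_local (hT : Tendsto θ atTop (𝓝 T)) :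
    ∃ σ₂ c : ℝ, σ₀ ≤ σ₂ ∧ 1 < c ∧ (∀ σ, σ₂ < σ → ℓ (σ + P) = c * ℓ σ) ∧
      (∀ σ, σ₂ < σ → T - θ (σ + P) = (T - θ σ) / c ^ 2) ∧ (∀ σ, σ₂ < σ → θ σ < T) ∧
      (∀ σ, σ₂ < σ → ∀ x : E, u (T - (T - θ σ) / c ^ 2) x = c • u (θ σ) (c • x)) ∧
      ∃ m M : ℝ, 0 < m ∧ m ≤ M ∧
        ∀ σ, σ₂ < σ → m ≤ (T - θ σ) * ℓ σ ^ 2 ∧ (T - θ σ) * ℓ σ ^ 2 ≤ M := by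
  obtain ⟨σ₂, hσ₂, hb⟩ :=
    eventually_readout_add_period_eq hP hr hℓ hpos hgrow hθ hW hper hperQ hW0 hans hp hu heq
  have hlt : ∀ σ, σ₂ < σ → σ₀ < σ := fun σ hσ => lt_of_le_of_lt hσ₂ hσ
  obtain ⟨c, hc, h1, h2, h3, h4, h5⟩ := blowupRigidity_of_readoutPeriodic (σ₀ := σ₂) hP
    (fun s hs => hℓ s (hlt s hs)) (fun s hs => hpos s (hlt s hs)) hper
    (fun s hs => hans s (hlt s hs)) hb (fun s hs => hθ s (hlt s hs)) hT
  exact ⟨σ₂, c, hσ₂, hc, h1, h2, h3, h4, h5⟩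

end LocalReadout

end Summit.NavierStokesRegularity.FluidComputer.SelfSimilarCensus

end
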